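import Summits.ResolutionOfSingularities.ResolutionOfSingularities.Theses.EquisingularLift
import Literature.AlgebraicGeometry.Resolution.Temkin2008Localization
import HarnessLib

/-!
# `EquisingularLift` — negative lemma: in skeleton v10 (LINEAR-CENTRE) the conjunct `𝔞 ≠ ⊥` of the
# blow-up-model predicate is load-bearing

Support (negative) lemma for crux `stmt-ResolutionOfSingularities-15660`
(`Summit.ResolutionOfSingularities.ResolutionOfSingularities.Theses.EquisingularLift.EquisingularLift`),
filed by triager 1 (res-L1-w45b-tri-1, gen 2; vacuity / junk-model audit of the registered skeleton v10 of
lead res-L1-w45b-lead-1, stubs in namespace `…Cruxes.EquisingularLift.StrataSplit`). [OURS · L1 W4.5b]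
No definition is declared and no theorem asserts a Theses decl positively.

The v10 stubs `stub_EL_of_blowupModel` / `stub_blowupModel_three` / `_four` / `_ge_five` are phrased with
the predicate `∃ 𝔞 : H.IdealSheafData, 𝔞 ≠ ⊥ ∧ ∀ Z π, IsBlowup π 𝔞 → Scheme.IsRegular Z` ("`H` has a
non-zero ideal sheaf all of whose blow-ups are regular" = a projective resolution of the integral `H`).
`blowupModel_trivial_without_ne_bot`: with `𝔞 ≠ ⊥` DELETED the predicate holds for EVERY scheme — take
`𝔞 = ⊥`; a blow-up along the zero ideal sheaf is empty (`IsBlowup.isEmpty_of_bot`, Temkin 2008 Def. 2.2.6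
"`Bl_X(X) = ∅`") and the empty scheme is regular vacuously. Consequently the residual stub
`stub_blowupModel_ge_five` minus `𝔞 ≠ ⊥` is a triviality (`stub_blowupModel_ge_five_trivial_without_ne_bot`,
same binders verbatim) and `stub_EL_of_blowupModel` minus `𝔞 ≠ ⊥` would be the crux itself with a contentless
hypothesis: every proof along the line must use `𝔞 ≠ ⊥`, and the registered skeleton does carry it.
Kernel-only (propext, Classical.choice, Quot.sound).
-/

noncomputable section

set_option linter.dupNamespace false

open CategoryTheory AlgebraicGeometry TopologicalSpace
open Literature.AlgebraicGeometry.Motives Literature.AlgebraicGeometry.Resolution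

universe u

namespace Summit.ResolutionOfSingularities.ResolutionOfSingularities.Theorems.EquisingularLift.Negative

/-- **`𝔞 ≠ ⊥` is load-bearing in the v10 blow-up-model predicate.** For every scheme `H` there is an
ideal sheaf (namely `⊥`) all of whose blow-ups are regular: they are empty (`IsBlowup.isEmpty_of_bot`).
[cite: Temkin2008, Def. 2.2.6] -/
theorem blowupModel_trivial_without_ne_bot (H : Scheme.{u}) :
    ∃ 𝔞 : H.IdealSheafData, ∀ (Z : Scheme.{u}) (π : Z ⟶ H), IsBlowup π 𝔞 → Scheme.IsRegular Z :=
  ⟨⊥, fun _Z _π hπ z => ((IsBlowup.isEmpty_of_bot hπ).false z).elim⟩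

/-- The residual stub `stub_blowupModel_ge_five` of skeleton v10 with the conjunct `𝔞 ≠ ⊥` deleted
(everything else verbatim) is trivially true — so the open content of the residual (resolution of
hypersurfaces of `ℙⁿ_k̄`, `n ≥ 5`, by one projective blow-up) sits entirely in `𝔞 ≠ ⊥`. [folklore] -/
theorem stub_blowupModel_ge_five_trivial_without_ne_bot : ∀ p : ℕ, p.Prime → ∀ (k : Type) [Field k] [CharP k p] [IsAlgClosed k] (n : ℕ) (H : AlgebraicGeometry.Scheme.{0}) (ι : H ⟶ (Literature.AlgebraicGeometry.Motives.projectiveSpace n k).left), AlgebraicGeometry.IsClosedImmersion ι → AlgebraicGeometry.IsIntegral H → (∀ y : (Literature.AlgebraicGeometry.Motives.projectiveSpace n k).left, ∃ U : (Literature.AlgebraicGeometry.Motives.projectiveSpace n k).left.affineOpens, y ∈ (U : (Literature.AlgebraicGeometry.Motives.projectiveSpace n k).left.Opens) ∧ (ι.ker.ideal U).IsPrincipal) → 5 ≤ n → ∃ 𝔞 : H.IdealSheafData, ∀ (Z : AlgebraicGeometry.Scheme.{0}) (π : Z ⟶ H), Literature.AlgebraicGeometry.Resolution.IsBlowup π 𝔞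 → Literature.AlgebraicGeometry.Resolution.Scheme.IsRegular Z :=
  fun _p _ _k _ _ _ _n H _ι _ _ _ _ => blowupModel_trivial_without_ne_bot H

/-- The witness `𝔞 = ⊥` is the ONLY junk of this kind on an integral `H`: a blow-up model with `𝔞 = ⊥`
has an empty total space, so it is never isomorphic over `H` to a scheme with a point — in particular the
v10 predicate WITH `𝔞 ≠ ⊥` is not satisfied by it (recorded as the contrapositive: a blow-up with a point
is not a blow-up of `⊥`). [folklore] -/
theorem ne_bot_of_isBlowup_of_nonempty {Z H : Scheme.{u}} {π : Z ⟶ H} {𝔞 : H.IdealSheafData}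
    (hπ : IsBlowup π 𝔞) [Nonempty Z] : 𝔞 ≠ ⊥ := by
  rintro rfl
  exact (IsBlowup.isEmpty_of_bot hπ).false (Classical.arbitrary Z)

end Summit.ResolutionOfSingularities.ResolutionOfSingularities.Theorems.EquisingularLift.Negative

end
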